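/-
Copyright: cell pub-balaban-gaps, seat ne8 (estimate NE7c), gen 14. Project licence.
-/
import Summits.QuantumFields.BalabanUV.T4Continuum.Spine.NE7b.CompactFibreWindowSU2DoublingHaar

/-!
# The live factor's window-volume price on `SU(2)` is EXACT: `Haar(W_{νt}) ∕ Haar(W_t) → ν^{3∕2}` as `t → 0⁺`, so the constant `1`
# of the doubling bound `(√ν)³·Haar(W_t) ≤ Haar(W_{νt})` cannot be raised — road (δ)'s loss `(3∕2)·log ν⁻¹` per plaquette variable
# in the volume currency is attained in the small-window regime (row NE7c; junction J-16's sharpness half; MODEL, [folklore])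

Cell `pub-balaban-gaps` (G2), seat ne8, estimate **NE7c** (`T4IndicatorShell.ShellWeightBound`; two-run artefact, NOT PRINTED in
[Bałaban 1983–89], NOT PROVED).  Proof-only file under `Spine/NE7c/`: imports seat ne6 GEN 16's junction V40c
`Spine/NE7b/CompactFibreWindowSU2DoublingHaar` (hence V40a `CompactFibreWindowSU2Exact` — the cap law
`Haar_{SU(2)}{Re tr V ≥ 2cos ψ} = (ψ − sin ψ cos ψ)∕π` — and V40b `CompactFibreWindowSU2Doubling`), Mathlib real analysis otherwise.
Nothing of Bałaban's is named; no `def`; 0 `sorry`.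

THE QUESTION (seat census `HOME/ne/NE7c.md` §21, row 48 (iii)).  File 30 (`LiveFactorWindowDoubling`) reads V38 ∕ V40c's doubling at a live
window: `(√ν)³·Haar(W_t) ≤ Haar(W_{νt})` on `SU(2)` for every `0 < ν ≤ 1` and every level `t` (`W_t = {Re tr(1 − V) ≤ t}`), i.e. the live
factor costs AT MOST `(3∕2)·log ν⁻¹` per plaquette variable in the volume currency, with constant `1`.  Is that loss really there, or an
artefact of the bounds — could a finer reading make the window-volume letter FREE under road (δ)?

ANSWER ([folklore] real analysis on V40a's exact law): the loss is EXACT in the small-window regime.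
* §1 the cap function near `0`: `abs_capFun_sub_le` (`|(ψ − sin ψ cos ψ) − (2∕3)ψ³| ≤ (4∕25)|ψ|⁵` for `|ψ| ≤ ½`, from Mathlib's
  `Real.sin_bound` at `2ψ`), `capFun_pos`, `tendsto_capFun_div_cube` (`(ψ − sin ψ cos ψ)∕ψ³ → 2∕3` as `ψ → 0⁺`),
  `tendsto_sin_div_self_nhdsGT` (`sin x∕x → 1`), `tendsto_capProfile_nhdsGT` (`(ψ − sin ψ cos ψ)∕sin³(ψ∕2) → 16∕3` — the value at `0⁺`
  of V40b's antitone cap profile).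
* §2 the window function in the angle and in the level: `window_angle_eq` (`Haar(W_{2−2cos ψ}) = (ψ − sin ψ cos ψ)∕π`, `0 ≤ ψ ≤ π`),
  `sqrt_level_cube_eq` (`(√(2 − 2cos ψ))³ = 8 sin³(ψ∕2)`), `window_eq_of_le_four` ∕ `window_pos` (at `ψ_t = arccos(1 − t∕2)`),
  `tendsto_angle_nhdsGT` (`ψ_t → 0⁺` as `t → 0⁺`) and **`tendsto_window_div_sqrt_cube`**: `Haar(W_t)∕(√t)³ → 2∕(3π)` as `t → 0⁺` —
  the (n)-carrier's `SU(2)` window-volume function is `~ (2∕(3π))·t^{3∕2}` (the sharp form of V26's `t√t∕160 ≤ Haar(W_t) ≤ 12t√t`).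
* §3 **`tendsto_live_ratio`**: for every `ν > 0`, `Haar(W_{νt})∕Haar(W_t) → (√ν)³` as `t → 0⁺`; **`exists_live_ratio_lt`**: for every
  `0 < ν` and `ε > 0` there is a level `t > 0` with `Haar(W_t) > 0` and `Haar(W_{νt}) < ((√ν)³ + ε)·Haar(W_t)` — the constant `1` in
  file 30's `live_traceWindow_ge_sharp` is best possible, uniformly in nothing but the truth.

CENSUS (row 48 (iii), NEW): road (δ)'s price in the window-VOLUME currency — `½d(𝔤)·log ν⁻¹` per plaquette variable RELATIVE to the
unlowered letter — is ATTAINED as the window shrinks (`SU(2)`, `d(𝔤) = 3`): the MILD loss of rows 44 ∕ 47 (i) ∕ 48 (i) is not an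
artefact of the two-sided laws and no finer reading of the lineage's volume letters makes it FREE; what IS free is print's own constant
`log σ₀` (file 30).  BY-NAME EFFECT ON THE WALL: none (junction ∕ census file).

NOT HERE (honest): `SU(N)`, `N ≥ 3` (needs the rank-`N−1` Weyl formula; V38's soft `D` only bounds the ratio); which `t(g_k)` Bałaban's
step carries — ne6's (A3) ∕ (A1c) list applies verbatim (NC-NE7b-α UNRULED); node O; NE7c.  VERDICT WORD UNCHANGED: WORK-bound behind
node O; INSTANCE 0∕1.  NE7c ∕ NE7b NOT PRINTED ∕ NOT PROVED; spine 0∕9; one finite T⁴ — NOT ℝ⁴, NOT infinite volume, NOT the mass gap,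
NOT Clay.
HONEST DEPENDENCY (cell): continuum YM on T⁴ ⇐ BetaPertH ∧ nine spine estimates (0∕9 proved); BetaPertH ⇐ (D1) ∧ (D4) ∧ CAP+tail.
-/

set_option autoImplicit false

noncomputable section

open MeasureTheory Real Filter Set Topology
open Literature.MathematicalPhysics.QuantumFieldTheory (haarProbability)
open Summit.QuantumFields.BalabanUV.T4Continuum.NE7b.CompactFibreWindowSU2Exact (haar_traceCap_angle_eq)
open Summit.QuantumFields.BalabanUV.T4Continuum.NE7b.CompactFibreWindowSU2Doubling (two_sub_two_cos exists_angle_of_level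
  capFun_nonneg)
open Summit.QuantumFields.BalabanUV.T4Continuum.NE7b.CompactFibreWindowSU2DoublingHaar (re_trace_one_sub_eq abs_re_trace_le_two)

namespace Summit.QuantumFields.BalabanUV.T4Continuum.Spine.NE7c.LiveFactorWindowTight

/-! ## §1 The cap function `ψ − sin ψ cos ψ` near `0` -/

/-- `ψ − sin ψ cos ψ = ψ − sin(2ψ)∕2`. [folklore] -/
theorem capFun_eq (ψ : ℝ) : ψ - Real.sin ψ * Real.cos ψ = ψ - Real.sin (2 * ψ) / 2 := by
  rw [Real.sin_two_mul]; ring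

/-- **THE CUBIC GERM OF THE CAP FUNCTION**: `|(ψ − sin ψ cos ψ) − (2∕3)ψ³| ≤ (4∕25)·|ψ|⁵` for `|ψ| ≤ ½` (Mathlib's `Real.sin_bound` at
`2ψ`). [folklore] -/
theorem abs_capFun_sub_le {ψ : ℝ} (hψ : |ψ| ≤ 1 / 2) :
    |(ψ - Real.sin ψ * Real.cos ψ) - 2 / 3 * ψ ^ 3| ≤ 4 / 25 * |ψ| ^ 5 := by
  have h2 : |2 * ψ| ≤ 1 := by rw [abs_mul, abs_two]; linarith
  have hb := Real.sin_bound h2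
  have e : (ψ - Real.sin ψ * Real.cos ψ) - 2 / 3 * ψ ^ 3 = -(1 / 2) * (Real.sin (2 * ψ) - (2 * ψ - (2 * ψ) ^ 3 / 6)) := by
    rw [capFun_eq]; ring
  have e2 : |2 * ψ| ^ 5 = 32 * |ψ| ^ 5 := by rw [abs_mul, abs_two]; ring
  rw [e, abs_mul, abs_neg, abs_of_pos (by norm_num : (0 : ℝ) < 1 / 2)]
  rw [e2] at hb
  linarith

/-- The cap function is positive for `ψ > 0` (`sin 2ψ < 2ψ`). [folklore] -/
theorem capFun_pos {ψ : ℝ} (hψ : 0 < ψ) : 0 < ψ - Real.sin ψ * Real.cos ψ := by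
  rw [capFun_eq]
  have := Real.sin_lt (by linarith : 0 < 2 * ψ)
  linarith

/-- **`(ψ − sin ψ cos ψ)∕ψ³ → 2∕3` as `ψ → 0⁺`.** [folklore] -/
theorem tendsto_capFun_div_cube :
    Tendsto (fun ψ : ℝ => (ψ - Real.sin ψ * Real.cos ψ) / ψ ^ 3) (𝓝[>] 0) (𝓝 (2 / 3)) := by
  have key : ∀ ψ : ℝ, 0 < ψ → ψ ≤ 1 / 2 → |(ψ - Real.sin ψ * Real.cos ψ) / ψ ^ 3 - 2 / 3| ≤ 4 / 25 * ψ ^ 2 := by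
    intro ψ h0 h1
    have hψ3 : 0 < ψ ^ 3 := by positivity
    have hb := abs_capFun_sub_le (show |ψ| ≤ 1 / 2 by rw [abs_of_pos h0]; exact h1)
    rw [abs_of_pos h0] at hb
    have e : (ψ - Real.sin ψ * Real.cos ψ) / ψ ^ 3 - 2 / 3 = ((ψ - Real.sin ψ * Real.cos ψ) - 2 / 3 * ψ ^ 3) / ψ ^ 3 := by
      field_simp
    rw [e, abs_div, abs_of_pos hψ3, div_le_iff₀ hψ3]
    calc |(ψ - Real.sin ψ * Real.cos ψ) - 2 / 3 * ψ ^ 3| ≤ 4 / 25 * ψ ^ 5 := hb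
      _ = 4 / 25 * ψ ^ 2 * ψ ^ 3 := by ring
  have hg : Tendsto (fun ψ : ℝ => 4 / 25 * ψ ^ 2) (𝓝[>] 0) (𝓝 0) := by
    have h : Tendsto (fun ψ : ℝ => 4 / 25 * ψ ^ 2) (𝓝 0) (𝓝 (4 / 25 * (0 : ℝ) ^ 2)) :=
      ((continuous_const.mul (continuous_pow 2)).tendsto 0)
    rw [zero_pow two_ne_zero, mul_zero] at h
    exact h.mono_left nhdsWithin_le_nhds
  have hev : ∀ᶠ ψ in 𝓝[>] (0 : ℝ), ‖(ψ - Real.sin ψ * Real.cos ψ) / ψ ^ 3 - 2 / 3‖ ≤ 4 / 25 * ψ ^ 2 := by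
    filter_upwards [Ioo_mem_nhdsGT (show (0 : ℝ) < 1 / 2 by norm_num)] with ψ hψ
    rw [Real.norm_eq_abs]
    exact key ψ hψ.1 hψ.2.le
  have h0 : Tendsto (fun ψ : ℝ => (ψ - Real.sin ψ * Real.cos ψ) / ψ ^ 3 - 2 / 3) (𝓝[>] 0) (𝓝 0) :=
    squeeze_zero_norm' hev hg
  exact tendsto_sub_nhds_zero_iff.1 h0

/-- **`sin x ∕ x → 1` as `x → 0⁺`** (from `x − x³∕6 < sin x < x`). [folklore] -/
theorem tendsto_sin_div_self_nhdsGT : Tendsto (fun x : ℝ => Real.sin x / x) (𝓝[>] 0) (𝓝 1) := by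
  have key : ∀ x : ℝ, 0 < x → |Real.sin x / x - 1| ≤ x ^ 2 / 6 := by
    intro x hx
    have h1 := Real.sin_lt hx
    have h2 := Real.sin_gt_sub_cube hx
    have eq : Real.sin x / x - 1 = (Real.sin x - x) / x := by field_simp
    rw [eq, abs_div, abs_of_pos hx, div_le_iff₀ hx, abs_le]
    constructor <;> nlinarith
  have hg : Tendsto (fun x : ℝ => x ^ 2 / 6) (𝓝[>] 0) (𝓝 0) := by
    have h : Tendsto (fun x : ℝ => x ^ 2 / 6) (𝓝 0) (𝓝 ((0 : ℝ) ^ 2 / 6)) := ((continuous_pow 2).div_const 6).tendsto 0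
    rw [zero_pow two_ne_zero, zero_div] at h
    exact h.mono_left nhdsWithin_le_nhds
  have hev : ∀ᶠ x in 𝓝[>] (0 : ℝ), ‖Real.sin x / x - 1‖ ≤ x ^ 2 / 6 := by
    filter_upwards [self_mem_nhdsWithin] with x hx
    rw [Real.norm_eq_abs]
    exact key x hx
  exact tendsto_sub_nhds_zero_iff.1 (squeeze_zero_norm' hev hg)

/-- **THE CAP PROFILE AT `0⁺`**: `(ψ − sin ψ cos ψ)∕sin³(ψ∕2) → 16∕3` as `ψ → 0⁺` — the supremum of V40b's antitone profile
(`antitoneOn_capProfile`) is `16∕3`. [folklore] -/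
theorem tendsto_capProfile_nhdsGT :
    Tendsto (fun ψ : ℝ => (ψ - Real.sin ψ * Real.cos ψ) / Real.sin (ψ / 2) ^ 3) (𝓝[>] 0) (𝓝 (16 / 3)) := by
  -- `ψ ↦ ψ/2` maps `0⁺` to `0⁺`; `sin(ψ/2)/(ψ/2) → 1`, hence the cube of its inverse `→ 1`
  have hhalf : Tendsto (fun ψ : ℝ => ψ / 2) (𝓝[>] 0) (𝓝[>] 0) := by
    refine tendsto_nhdsWithin_of_tendsto_nhds_of_eventually_within _ ?_ ?_
    · have h : Tendsto (fun ψ : ℝ => ψ / 2) (𝓝 0) (𝓝 ((0 : ℝ) / 2)) := (continuous_id.div_const 2).tendsto 0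
      rw [zero_div] at h
      exact h.mono_left nhdsWithin_le_nhds
    · filter_upwards [self_mem_nhdsWithin] with ψ hψ
      exact half_pos (show 0 < ψ from hψ)
  have hs : Tendsto (fun ψ : ℝ => Real.sin (ψ / 2) / (ψ / 2)) (𝓝[>] 0) (𝓝 1) :=
    tendsto_sin_div_self_nhdsGT.comp hhalf
  have hinv : Tendsto (fun ψ : ℝ => (Real.sin (ψ / 2) / (ψ / 2))⁻¹) (𝓝[>] 0) (𝓝 1) := by
    simpa using hs.inv₀ one_ne_zero
  have hcube : Tendsto (fun ψ : ℝ => ((Real.sin (ψ / 2) / (ψ / 2))⁻¹) ^ 3) (𝓝[>] 0) (𝓝 1) := by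
    simpa using hinv.pow 3
  have hprod := (tendsto_capFun_div_cube.mul hcube).mul_const 8
  have hlim : (2 / 3 : ℝ) * 1 * 8 = 16 / 3 := by norm_num
  rw [hlim] at hprod
  refine hprod.congr' ?_
  filter_upwards [Ioo_mem_nhdsGT (show (0 : ℝ) < 2 * Real.pi by positivity)] with ψ hψ
  have hψ0 : 0 < ψ := hψ.1
  have hsin : 0 < Real.sin (ψ / 2) := Real.sin_pos_of_pos_of_lt_pi (half_pos hψ0) (by linarith [hψ.2])
  field_simp
  ring

/-! ## §2 The window-volume function of the (n)-carrier on `SU(2)` in the angle and in the level -/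

/-- **THE WINDOW AT AN ANGLE** (V40a's cap law in the window currency): for `0 ≤ ψ ≤ π`,
`Haar_{SU(2)}{Re tr(1 − V) ≤ 2 − 2cos ψ} = (ψ − sin ψ cos ψ)∕π`. [folklore] -/
theorem window_angle_eq {ψ : ℝ} (h0 : 0 ≤ ψ) (hπ : ψ ≤ Real.pi) :
    (haarProbability (Matrix.specialUnitaryGroup (Fin 2) ℂ)).real
        {V : Matrix.specialUnitaryGroup (Fin 2) ℂ | (Matrix.trace (1 - (V : Matrix (Fin 2) (Fin 2) ℂ))).re ≤ 2 - 2 * Real.cos ψ}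
      = (ψ - Real.sin ψ * Real.cos ψ) / Real.pi := by
  have hset : {V : Matrix.specialUnitaryGroup (Fin 2) ℂ | (Matrix.trace (1 - (V : Matrix (Fin 2) (Fin 2) ℂ))).re ≤ 2 - 2 * Real.cos ψ}
      = {V : Matrix.specialUnitaryGroup (Fin 2) ℂ | 2 * Real.cos ψ ≤ (Matrix.trace (V : Matrix (Fin 2) (Fin 2) ℂ)).re} := by
    ext V; simp only [Set.mem_setOf_eq, re_trace_one_sub_eq]; constructor <;> intro h <;> linarith
  rw [hset, measureReal_def, haar_traceCap_angle_eq h0 hπ,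
    ENNReal.toReal_ofReal (div_nonneg (capFun_nonneg h0) Real.pi_pos.le)]

/-- `(√(2 − 2cos ψ))³ = 8·sin³(ψ∕2)` for `sin(ψ∕2) ≥ 0`. [folklore] -/
theorem sqrt_level_cube_eq {ψ : ℝ} (hs : 0 ≤ Real.sin (ψ / 2)) : Real.sqrt (2 - 2 * Real.cos ψ) ^ 3 = 8 * Real.sin (ψ / 2) ^ 3 := by
  rw [two_sub_two_cos, show 4 * Real.sin (ψ / 2) ^ 2 = (2 * Real.sin (ψ / 2)) ^ 2 by ring, Real.sqrt_sq (by linarith)]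
  ring

/-- **THE WINDOW AT A LEVEL `0 < t ≤ 4`**: with `ψ_t = arccos(1 − t∕2)` (V40b's `exists_angle_of_level`),
`Haar(W_t) = (ψ_t − sin ψ_t cos ψ_t)∕π`, `(√t)³ = 8 sin³(ψ_t∕2)`, `0 < ψ_t ≤ π` and `0 < sin(ψ_t∕2)`. [folklore] -/
theorem window_eq_of_le_four {t : ℝ} (h0 : 0 < t) (h4 : t ≤ 4) :
    (haarProbability (Matrix.specialUnitaryGroup (Fin 2) ℂ)).real
        {V : Matrix.specialUnitaryGroup (Fin 2) ℂ | (Matrix.trace (1 - (V : Matrix (Fin 2) (Fin 2) ℂ))).re ≤ t}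
      = (Real.arccos (1 - t / 2) - Real.sin (Real.arccos (1 - t / 2)) * Real.cos (Real.arccos (1 - t / 2))) / Real.pi ∧
    Real.sqrt t ^ 3 = 8 * Real.sin (Real.arccos (1 - t / 2) / 2) ^ 3 ∧
    0 < Real.arccos (1 - t / 2) ∧ Real.arccos (1 - t / 2) ≤ Real.pi ∧ 0 < Real.sin (Real.arccos (1 - t / 2) / 2) := by
  obtain ⟨ψ, hψ0, hψπ, hlev, -, hsin, hψdef⟩ := exists_angle_of_level h0 h4
  rw [← hψdef]
  refine ⟨?_, ?_, hψ0, hψπ, hsin⟩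
  · rw [← hlev]; exact window_angle_eq hψ0.le hψπ
  · rw [← hlev]; exact sqrt_level_cube_eq hsin.le
    
/-- **EVERY WINDOW OF POSITIVE LEVEL HAS POSITIVE VOLUME** on `SU(2)`. [folklore] -/
theorem window_pos {t : ℝ} (h0 : 0 < t) :
    0 < (haarProbability (Matrix.specialUnitaryGroup (Fin 2) ℂ)).real
        {V : Matrix.specialUnitaryGroup (Fin 2) ℂ | (Matrix.trace (1 - (V : Matrix (Fin 2) (Fin 2) ℂ))).re ≤ t} := by
  rcases le_or_gt t 4 with h4 | h4
  · obtain ⟨heq, -, hψ0, -, -⟩ := window_eq_of_le_four h0 h4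
    rw [heq]; exact div_pos (capFun_pos hψ0) Real.pi_pos
  · have huniv : {V : Matrix.specialUnitaryGroup (Fin 2) ℂ | (Matrix.trace (1 - (V : Matrix (Fin 2) (Fin 2) ℂ))).re ≤ t} = Set.univ :=
      Set.eq_univ_of_forall fun V => by
        rw [Set.mem_setOf_eq, re_trace_one_sub_eq]; linarith [(abs_le.1 (abs_re_trace_le_two V)).1]
    rw [huniv, probReal_univ]; exact one_pos

/-- `ψ_t = arccos(1 − t∕2) → 0⁺` as `t → 0⁺`. [folklore] -/
theorem tendsto_angle_nhdsGT : Tendsto (fun t : ℝ => Real.arccos (1 - t / 2)) (𝓝[>] 0) (𝓝[>] 0) := by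
  refine tendsto_nhdsWithin_of_tendsto_nhds_of_eventually_within _ ?_ ?_
  · have hc : Continuous fun t : ℝ => Real.arccos (1 - t / 2) :=
      Real.continuous_arccos.comp (continuous_const.sub (continuous_id.div_const 2))
    have h := hc.tendsto 0
    simp only [zero_div, sub_zero, Real.arccos_one] at h
    exact h.mono_left nhdsWithin_le_nhds
  · filter_upwards [self_mem_nhdsWithin] with t ht
    exact Real.arccos_pos.2 (by simp only [Set.mem_Ioi] at ht; linarith)

/-- **THE WINDOW-VOLUME FUNCTION OF `SU(2)` IS `~ (2∕(3π))·t^{3∕2}`**: `Haar_{SU(2)}{Re tr(1 − V) ≤ t} ∕ (√t)³ → 2∕(3π)` as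
`t → 0⁺`. [folklore] -/
theorem tendsto_window_div_sqrt_cube :
    Tendsto (fun t : ℝ => (haarProbability (Matrix.specialUnitaryGroup (Fin 2) ℂ)).real
        {V : Matrix.specialUnitaryGroup (Fin 2) ℂ | (Matrix.trace (1 - (V : Matrix (Fin 2) (Fin 2) ℂ))).re ≤ t} / Real.sqrt t ^ 3)
      (𝓝[>] 0) (𝓝 (2 / (3 * Real.pi))) := by
  have h := (tendsto_capProfile_nhdsGT.comp tendsto_angle_nhdsGT).div_const (8 * Real.pi)
  have hval : (16 / 3 : ℝ) / (8 * Real.pi) = 2 / (3 * Real.pi) := by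
    field_simp; ring
  rw [hval] at h
  refine h.congr' ?_
  filter_upwards [Ioo_mem_nhdsGT (show (0 : ℝ) < 4 by norm_num)] with t ht
  obtain ⟨heq, hcube, -, -, hsin⟩ := window_eq_of_le_four ht.1 ht.2.le
  simp only [Function.comp_apply]
  rw [heq, hcube]
  field_simp

/-! ## §3 The live ratio is exact: `Haar(W_{νt})∕Haar(W_t) → ν^{3∕2}` -/

/-- **THE LIVE RATIO IS EXACT**: for every `ν > 0`, `Haar_{SU(2)}(W_{νt}) ∕ Haar_{SU(2)}(W_t) → (√ν)³` as `t → 0⁺`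
(`W_s = {Re tr(1 − V) ≤ s}`). [folklore] -/
theorem tendsto_live_ratio {ν : ℝ} (hν : 0 < ν) :
    Tendsto (fun t : ℝ =>
      (haarProbability (Matrix.specialUnitaryGroup (Fin 2) ℂ)).real
          {V : Matrix.specialUnitaryGroup (Fin 2) ℂ | (Matrix.trace (1 - (V : Matrix (Fin 2) (Fin 2) ℂ))).re ≤ ν * t} /
        (haarProbability (Matrix.specialUnitaryGroup (Fin 2) ℂ)).real
          {V : Matrix.specialUnitaryGroup (Fin 2) ℂ | (Matrix.trace (1 - (V : Matrix (Fin 2) (Fin 2) ℂ))).re ≤ t})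
      (𝓝[>] 0) (𝓝 (Real.sqrt ν ^ 3)) := by
  have hc : (2 / (3 * Real.pi) : ℝ) ≠ 0 := by positivity
  -- `t ↦ νt` maps `0⁺` to `0⁺`; `A(νt) → 2/(3π)`, `A(t)⁻¹ → (2/(3π))⁻¹`, where `A(s) = Haar(W_s)/(√s)³`
  have hmul : Tendsto (fun t : ℝ => ν * t) (𝓝[>] 0) (𝓝[>] 0) := by
    refine tendsto_nhdsWithin_of_tendsto_nhds_of_eventually_within _ ?_ ?_
    · have h : Tendsto (fun t : ℝ => ν * t) (𝓝 0) (𝓝 (ν * 0)) := (continuous_const.mul continuous_id).tendsto 0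
      rw [mul_zero] at h
      exact h.mono_left nhdsWithin_le_nhds
    · filter_upwards [self_mem_nhdsWithin] with t ht
      exact mul_pos hν ht
  have hA := tendsto_window_div_sqrt_cube.comp hmul
  have hB := tendsto_window_div_sqrt_cube.inv₀ hc
  have hprod := (hA.mul hB).const_mul (Real.sqrt ν ^ 3)
  have hval : Real.sqrt ν ^ 3 * (2 / (3 * Real.pi) * (2 / (3 * Real.pi))⁻¹) = Real.sqrt ν ^ 3 := by
    rw [mul_inv_cancel₀ hc, mul_one]
  rw [hval] at hprod
  refine hprod.congr' ?_
  filter_upwards [self_mem_nhdsWithin] with t ht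
  have ht0 : 0 < t := ht
  have hmt : 0 < (haarProbability (Matrix.specialUnitaryGroup (Fin 2) ℂ)).real
      {V : Matrix.specialUnitaryGroup (Fin 2) ℂ | (Matrix.trace (1 - (V : Matrix (Fin 2) (Fin 2) ℂ))).re ≤ t} :=
    window_pos ht0
  have hst : 0 < Real.sqrt t ^ 3 := pow_pos (Real.sqrt_pos.2 ht0) 3
  have hsν : Real.sqrt (ν * t) ^ 3 = Real.sqrt ν ^ 3 * Real.sqrt t ^ 3 := by
    rw [Real.sqrt_mul hν.le, mul_pow]
  simp only [Function.comp_apply]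
  rw [hsν]
  field_simp

/-- **THE CONSTANT `1` OF FILE 30's `(√ν)³·Haar(W_t) ≤ Haar(W_{νt})` IS BEST POSSIBLE**: for every `ν > 0` and `ε > 0` there is a
level `t > 0` with `Haar(W_t) > 0` and `Haar(W_{νt}) < ((√ν)³ + ε)·Haar(W_t)` — the live factor's volume price `(3∕2)·log ν⁻¹` per
plaquette variable is attained in the small-window regime. [folklore] -/
theorem exists_live_ratio_lt {ν ε : ℝ} (hν : 0 < ν) (hε : 0 < ε) :
    ∃ t : ℝ, 0 < t ∧
      0 < (haarProbability (Matrix.specialUnitaryGroup (Fin 2) ℂ)).real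
          {V : Matrix.specialUnitaryGroup (Fin 2) ℂ | (Matrix.trace (1 - (V : Matrix (Fin 2) (Fin 2) ℂ))).re ≤ t} ∧
      (haarProbability (Matrix.specialUnitaryGroup (Fin 2) ℂ)).real
          {V : Matrix.specialUnitaryGroup (Fin 2) ℂ | (Matrix.trace (1 - (V : Matrix (Fin 2) (Fin 2) ℂ))).re ≤ ν * t}
        < (Real.sqrt ν ^ 3 + ε) * (haarProbability (Matrix.specialUnitaryGroup (Fin 2) ℂ)).real
          {V : Matrix.specialUnitaryGroup (Fin 2) ℂ | (Matrix.trace (1 - (V : Matrix (Fin 2) (Fin 2) ℂ))).re ≤ t} := by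
  have hlt : ∀ᶠ t in 𝓝[>] (0 : ℝ),
      (haarProbability (Matrix.specialUnitaryGroup (Fin 2) ℂ)).real
          {V : Matrix.specialUnitaryGroup (Fin 2) ℂ | (Matrix.trace (1 - (V : Matrix (Fin 2) (Fin 2) ℂ))).re ≤ ν * t} /
        (haarProbability (Matrix.specialUnitaryGroup (Fin 2) ℂ)).real
          {V : Matrix.specialUnitaryGroup (Fin 2) ℂ | (Matrix.trace (1 - (V : Matrix (Fin 2) (Fin 2) ℂ))).re ≤ t}
        < Real.sqrt ν ^ 3 + ε :=
    (tendsto_live_ratio hν).eventually (Iio_mem_nhds (by linarith))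
  obtain ⟨t, ⟨hrat, ht⟩⟩ := (hlt.and self_mem_nhdsWithin).exists
  have ht0 : 0 < t := ht
  have hmt := window_pos (t := t) ht0
  refine ⟨t, ht0, hmt, ?_⟩
  rwa [div_lt_iff₀ hmt] at hrat

end Summit.QuantumFields.BalabanUV.T4Continuum.Spine.NE7c.LiveFactorWindowTight

end
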